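import Literature.Analysis.FluidPDE.NSFourierSolution
import Literature.Analysis.FluidPDE.NSFourierPlancherel
import Literature.Analysis.FluidPDE.ClassicalSolution
import Literature.Analysis.FluidPDE.LerayHopf
import Literature.Analysis.FluidPDE.NSWave0
import HarnessLib

/-!
# Leray's local regular solution for Schwartz-class data on `ℝ³` (existence theorem)

This file **proves** `Literature.Analysis.FluidPDE.local_regular_solution_exists`, the existence half of the named
fact `Literature.Analysis.FluidPDE.local_classical_lerayHopf` (`NSLocalClassical`; its Leray–Hopf half is the tree's
proved `Literature.Analysis.FluidPDE.IsClassicalNSSolutionOn.isLerayHopfOn_holds`, Leray 1934 §32):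

for `ν > 0` and `u₀ : ℝ³ → ℝ³` smooth, divergence free and rapidly decaying (Fefferman (4))
there are `T > 0` and `(u, p)` with `(u, p)` a classical solution of the unforced Navier–Stokes
system on the closed slab `ℝ³ × [0, T]` (`IsClassicalNSSolutionOn (Icc 0 T) ν 0 u p`), `u 0 = u₀`,
`u ∈ C([0, T]; L²)`, `∇u ∈ L²((0,T) × ℝ³)`, `u ∈ L³((0,T) × ℝ³)` and `p u ∈ L¹((0,T) × ℝ³)` —
exactly the hypotheses consumed by `isLerayHopfOn_holds`.

In print: Leray 1934, §19 (pp. 222–223: for a regular datum there is a *solution régulière* on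
some `[0, τ)`; definition pp. 220–221, §§16–17: `W(t) = ‖u(t)‖₂`, `V(t) = ‖u(t)‖_∞`,
`J(t) = ‖∇u(t)‖₂` finite and continuous, energy equality (3.4); `u`, `∂u/∂xⱼ` continuous up to
`t = 0`, higher derivatives in the interior), restated with proofs by Ożański–Pooley 2018:
Thm. 6.22 (local strong solution, `u ∈ C([0,T); L²)`), Cor. 6.16 (`u, p ∈ C^∞(ℝ³ × (0,T))`, all
`∂ₜᵏ∇ᵐu, ∂ₜᵏ∇ᵐp ∈ C((0,T); L² ∩ L^∞)`), Lemma 6.21 (energy equality), Lemma 6.9 (iii)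
(`p ∈ C([0,T); L²)`). The formal statement is slightly stronger than these locators at `t = 0`:
`u` **and** `p` are jointly `C^∞` on the *closed* slab and the equations hold at `t = 0`. For
Schwartz-class data this is true — regularity up to `t = 0` in every norm is printed for
`H^m`-data, all `m`, by Majda–Bertozzi 2002, Thm. 3.4 (solution in `C([0,T]; C²) ∩ C¹([0,T]; C)`,
closed interval, with the `H^m` bounds (3.56)) and Thm. 3.5 — and it is **proved here**: the
proof below (files `NSFourier*`) constructs the solution as `u = Re 𝓕 v`, `p = Re 𝓕 q` from the
fixed point `v` of the Fourier-transformed Duhamel map (Leray's successive approximations, §19,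
run on the Fourier side in weighted sup norms), shows that all time derivatives of `v` exist as
continuous families on the closed interval `[0, T]` with every polynomial frequency decay
(`NSFourierTimeRegularity`), whence joint smoothness on the closed slab (`NSFourierSynthesis`),
verifies the equations through the Fourier dictionary (`NSFourierSolution`), and obtains the
integrability clauses from Plancherel (`NSFourierPlancherel`). `T` is Picard's time, strictly
inside the existence interval.

## Contents

* the integrability clauses for the fields of `FourierNS.ClayDatum` (`continuousInLpOn_u`,
  `gradient_sq_finite`, `cube_finite`, `pressure_velocity_finite`);
* `Literature.Analysis.FluidPDE.local_regular_solution_exists` — the existence theorem, assembled from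
  `FourierNS.ClayDatum.isClassicalNSSolutionOn`, `.u_zero` and the clauses above.

## References

* J. Leray, *Sur le mouvement d'un liquide visqueux emplissant l'espace*, Acta Math. 63 (1934),
  193–248, §§16–19, (3.4). [Leray1934]
* W. S. Ożański, B. C. Pooley, *Leray's fundamental work on the Navier–Stokes equations: a modern
  review*, in: Partial Differential Equations in Fluid Mechanics (Fefferman, Robinson, Rodrigo,
  eds.), LMS Lecture Notes 452, CUP 2018, Lemma 6.9, Cor. 6.16, Def. 6.20, Lemma 6.21, Thm. 6.22
  (arXiv:1708.09787). [OzanskiPooley2018]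
* A. J. Majda, A. L. Bertozzi, *Vorticity and Incompressible Flow*, CUP 2002, Thm. 3.4, Thm. 3.5,
  §3.2. [MajdaBertozzi2002]
* C. Fefferman, *Existence and smoothness of the Navier–Stokes equation*, Clay problem
  description (2000/2006), (4) and the discussion after (A)–(D).
-/

noncomputable section

open MeasureTheory Real Set Filter Topology Function Complex FourierTransform VectorFourier
  InnerProductSpace
open scoped FourierTransform RealInnerProductSpace ENNReal ComplexConjugate

namespace Literature.Analysis.FluidPDE.FourierNS

variable {ι : Type*} [Fintype ι] [DecidableEq ι]

/-! ### Squared `L²` norms of syntheses -/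

section SqInt

omit [DecidableEq ι]

variable {K₀ : ℕ} {B : ℝ} {f : EuclideanSpace ℝ ι → ℂ}

/-- A bounded integrable coefficient function is in `L²`. [folklore] -/
theorem memLp_two_of_hasDecay (hK₀ : Fintype.card ι < K₀) (hf : HasDecay K₀ B f)
    (hfm : AEStronglyMeasurable f volume) : MemLp f 2 volume :=
  memLp_two_of_bound (hf.integrable (finrank_lt_of_card_lt hK₀) hfm) hf.norm_le

/-- **Weighted bound on the squared `L²` norm**: `∫ ‖f‖² ≤ B² I_{K₀}` for `‖f‖ ≤ B (1+‖·‖)^{-K₀}`. [folklore] -/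
theorem lintegral_sq_le_of_hasDecay (hK₀ : Fintype.card ι < K₀) (hf : HasDecay K₀ B f) :
    ∫⁻ ξ, ‖f ξ‖ₑ ^ 2 ≤ ENNReal.ofReal (B ^ 2 * weightMass (EuclideanSpace ℝ ι) K₀) := by
  have hB := hf.nonneg
  have hI := integrable_inv_one_add_norm_pow (E := EuclideanSpace ℝ ι) (finrank_lt_of_card_lt hK₀)
  calc ∫⁻ ξ, ‖f ξ‖ₑ ^ 2 ≤ ∫⁻ ξ, ENNReal.ofReal (B ^ 2 * ((1 + ‖ξ‖) ^ K₀)⁻¹) := by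
        refine lintegral_mono fun ξ => ?_
        rw [← ofReal_norm, ← ENNReal.ofReal_pow (norm_nonneg _)]
        refine ENNReal.ofReal_le_ofReal ?_
        have h1 := hf ξ
        have hw := inv_one_add_norm_pow_le_one ξ K₀
        have hw0 : 0 ≤ ((1 + ‖ξ‖) ^ K₀)⁻¹ := by positivity
        calc ‖f ξ‖ ^ 2 ≤ (B * ((1 + ‖ξ‖) ^ K₀)⁻¹) ^ 2 := pow_le_pow_left₀ (norm_nonneg _) h1 2
          _ = B ^ 2 * ((1 + ‖ξ‖) ^ K₀)⁻¹ * ((1 + ‖ξ‖) ^ K₀)⁻¹ := by ring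
          _ ≤ B ^ 2 * ((1 + ‖ξ‖) ^ K₀)⁻¹ * 1 := by gcongr
          _ = B ^ 2 * ((1 + ‖ξ‖) ^ K₀)⁻¹ := mul_one _
    _ = ENNReal.ofReal (∫ ξ, B ^ 2 * ((1 + ‖ξ‖) ^ K₀)⁻¹ ∂volume) := by
        rw [ofReal_integral_eq_lintegral_ofReal (hI.const_mul _)
          (Eventually.of_forall fun ξ => by positivity)]
    _ = ENNReal.ofReal (B ^ 2 * weightMass (EuclideanSpace ℝ ι) K₀) := by
        rw [integral_const_mul, weightMass]

/-- `‖·‖₂` as the square root of `∫ ‖·‖²`. [folklore] -/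
theorem eLpNorm_two_eq_sqrt {α : Type*} [MeasurableSpace α] {μ : Measure α} {F : Type*}
    [NormedAddCommGroup F] (g : α → F) :
    eLpNorm g 2 μ = (∫⁻ x, ‖g x‖ₑ ^ 2 ∂μ) ^ (1 / 2 : ℝ) := by
  rw [eLpNorm_eq_lintegral_rpow_enorm_toReal (by norm_num) (by norm_num)]
  simp only [ENNReal.toReal_ofNat]
  congr 1
  refine lintegral_congr fun x => ?_
  rw [show (2 : ℝ) = (2 : ℕ) by norm_num, ENNReal.rpow_natCast]

/-- **Plancherel, squared form**: `∫ ‖𝓕 f‖² = ∫ ‖f‖²` for `f ∈ L¹ ∩ L²`. [folklore] -/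
theorem lintegral_sq_fourier_eq {f : EuclideanSpace ℝ ι → ℂ} (hf : Integrable f) (hf2 : MemLp f 2 volume) :
    ∫⁻ x, ‖𝓕 f x‖ₑ ^ 2 = ∫⁻ ξ, ‖f ξ‖ₑ ^ 2 := by
  have h := eLpNorm_fourierIntegral_eq hf hf2
  rw [eLpNorm_two_eq_sqrt, eLpNorm_two_eq_sqrt] at h
  have := congrArg (fun z : ℝ≥0∞ => z ^ (2 : ℝ)) h
  simpa only [← ENNReal.rpow_mul, one_div, inv_mul_cancel₀ (two_ne_zero (α := ℝ)), ENNReal.rpow_one]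
    using this

/-- The squared `L²` norm of a synthesis with decay of order `K₀`: `∫ ‖𝓕 f‖² ≤ B² I_{K₀}`. [folklore] -/
theorem lintegral_sq_fourier_le (hK₀ : Fintype.card ι < K₀) (hf : HasDecay K₀ B f)
    (hfm : AEStronglyMeasurable f volume) :
    ∫⁻ x, ‖𝓕 f x‖ₑ ^ 2 ≤ ENNReal.ofReal (B ^ 2 * weightMass (EuclideanSpace ℝ ι) K₀) := by
  rw [lintegral_sq_fourier_eq (hf.integrable (finrank_lt_of_card_lt hK₀) hfm)
    (memLp_two_of_hasDecay hK₀ hf hfm)]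
  exact lintegral_sq_le_of_hasDecay hK₀ hf

/-- The sup bound of a synthesis: `‖𝓕 f x‖ ≤ B I_{K₀}`. [folklore] -/
theorem norm_fourier_le_of_hasDecay (hK₀ : Fintype.card ι < K₀) (hf : HasDecay K₀ B f)
    (x : EuclideanSpace ℝ ι) : ‖𝓕 f x‖ ≤ B * weightMass (EuclideanSpace ℝ ι) K₀ := by
  have hI := integrable_inv_one_add_norm_pow (E := EuclideanSpace ℝ ι) (finrank_lt_of_card_lt hK₀)
  calc ‖𝓕 f x‖ ≤ ∫ ξ, ‖f ξ‖ := VectorFourier.norm_fourierIntegral_le_integral_norm _ _ _ _ _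
    _ ≤ ∫ ξ, B * ((1 + ‖ξ‖) ^ K₀)⁻¹ :=
        integral_mono_of_nonneg (Eventually.of_forall fun ξ => norm_nonneg _) (hI.const_mul B)
          (Eventually.of_forall hf)
    _ = B * weightMass (EuclideanSpace ℝ ι) K₀ := by rw [integral_const_mul, weightMass]

end SqInt

/-! ### Pointwise comparison of the real fields with their complex components -/

omit [DecidableEq ι] in
/-- `‖reVec z‖ₑ² ≤ ∑ₗ ‖z l‖ₑ²` (`‖y‖² = ∑ yₗ²`, `|Re z| ≤ ‖z‖`). [folklore] -/
theorem enorm_reVec_sq_le (z : ι → ℂ) : ‖ClayDatum.reVec z‖ₑ ^ 2 ≤ ∑ l, ‖z l‖ₑ ^ 2 := by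
  have h1 : ‖ClayDatum.reVec z‖ ^ 2 ≤ ∑ l, ‖z l‖ ^ 2 := by
    rw [EuclideanSpace.real_norm_sq_eq]
    refine Finset.sum_le_sum fun l _ => ?_
    rw [ClayDatum.reVec_apply, sq_le_sq, abs_norm]
    exact (Complex.abs_re_le_norm _)
  calc ‖ClayDatum.reVec z‖ₑ ^ 2 = ENNReal.ofReal (‖ClayDatum.reVec z‖ ^ 2) := by
        rw [← ofReal_norm, ENNReal.ofReal_pow (norm_nonneg _)]
    _ ≤ ENNReal.ofReal (∑ l, ‖z l‖ ^ 2) := ENNReal.ofReal_le_ofReal h1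
    _ = ∑ l, ‖z l‖ₑ ^ 2 := by
        rw [ENNReal.ofReal_sum_of_nonneg fun l _ => by positivity]
        refine Finset.sum_congr rfl fun l _ => ?_
        rw [← ofReal_norm, ENNReal.ofReal_pow (norm_nonneg _)]

omit [DecidableEq ι] in
/-- `‖reVec z‖ ≤ ∑ₗ ‖z l‖`. [folklore] -/
theorem norm_reVec_le (z : ι → ℂ) : ‖ClayDatum.reVec z‖ ≤ ∑ l, ‖z l‖ := by
  have h1 : ‖ClayDatum.reVec z‖ ^ 2 ≤ (∑ l, ‖z l‖) ^ 2 := by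
    rw [EuclideanSpace.real_norm_sq_eq]
    calc ∑ l, (ClayDatum.reVec z l) ^ 2 ≤ ∑ l, ‖z l‖ ^ 2 := by
          refine Finset.sum_le_sum fun l _ => ?_
          rw [ClayDatum.reVec_apply, sq_le_sq, abs_norm]
          exact (Complex.abs_re_le_norm _)
      _ ≤ (∑ l, ‖z l‖) ^ 2 := Finset.sum_sq_le_sq_sum_of_nonneg fun l _ => norm_nonneg _
  exact (pow_le_pow_iff_left₀ (norm_nonneg _) (Finset.sum_nonneg fun l _ => norm_nonneg _)
    two_ne_zero).1 h1

namespace ClayDatum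

variable (d : ClayDatum ι)

/-! ### Uniform weighted bounds -/

/-- Uniform decay of the derivative-weighted components `-2πi ζ_j v_l`. [folklore] -/
theorem hasDecay_dv_unif (j l : ι) : ∃ B, ∀ t, HasDecay d.K₀ B (fun ζ : EuclideanSpace ℝ ι =>
    (-(2 * π * I) * ((ζ j : ℝ) : ℂ)) * d.v t ζ l) := by
  obtain ⟨B, hB⟩ := d.decay_v_all (1 + d.K₀)
  refine ⟨2 * π * B, fun t => ?_⟩
  have := ((hB t).apply l)
  rw [Nat.add_comm] at this
  refine this.mul_linear (by positivity) fun ξ => ?_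
  rw [norm_mul, norm_neg, norm_mul, norm_mul, Complex.norm_two, Complex.norm_real,
    Complex.norm_I, mul_one, Real.norm_eq_abs, abs_of_pos Real.pi_pos, Complex.norm_real,
    Real.norm_eq_abs]
  exact mul_le_mul_of_nonneg_left (abs_apply_le_norm ξ j) (by positivity)

/-- Measurability of the derivative-weighted components. [folklore] -/
theorem aesm_dv (t : ℝ) (j l : ι) : AEStronglyMeasurable (fun ζ : EuclideanSpace ℝ ι =>
    (-(2 * π * I) * ((ζ j : ℝ) : ℂ)) * d.v t ζ l) volume :=
  (Continuous.aestronglyMeasurable (by fun_prop)).mul (d.aesm_v t l)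

/-- Time slices of `u` are continuous, hence a.e.-strongly measurable. [folklore] -/
theorem continuous_u (t : ℝ) : Continuous (d.u t) := by
  rw [u_eq_comp]
  exact (reVec (ι := ι)).continuous.comp (d.contDiff_Uvec t 0).continuous

/-- The squared `L²` norm of a velocity component is bounded uniformly in time:
`∫ ‖U_l(t)‖² ≤ R² I`. [folklore] -/
theorem lintegral_U_sq_le (t : ℝ) (l : ι) :
    ∫⁻ x, ‖d.U t x l‖ₑ ^ 2 ≤ ENNReal.ofReal (d.R ^ 2 * weightMass (EuclideanSpace ℝ ι) d.K₀) :=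
  lintegral_sq_fourier_le d.hK₀ ((d.decay_v t).apply l) (d.aesm_v t l)

/-- **`∫ ‖u(t)‖² ≤ card ι · R² I`**, uniformly in `t`. [folklore] -/
theorem lintegral_u_sq_le (t : ℝ) :
    ∫⁻ x, ‖d.u t x‖ₑ ^ 2 ≤ Fintype.card ι * ENNReal.ofReal (d.R ^ 2 * weightMass (EuclideanSpace ℝ ι) d.K₀) := by
  calc ∫⁻ x, ‖d.u t x‖ₑ ^ 2 ≤ ∫⁻ x, ∑ l, ‖d.U t x l‖ₑ ^ 2 := lintegral_mono fun x => enorm_reVec_sq_le _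
    _ = ∑ l, ∫⁻ x, ‖d.U t x l‖ₑ ^ 2 := by
        refine lintegral_finsetSum' _ fun l _ => ?_
        exact ((d.contDiff_U t l 0).continuous.measurable.enorm.pow_const 2).aemeasurable
    _ ≤ ∑ _l : ι, ENNReal.ofReal (d.R ^ 2 * weightMass (EuclideanSpace ℝ ι) d.K₀) :=
        Finset.sum_le_sum fun l _ => d.lintegral_U_sq_le t l
    _ = Fintype.card ι * ENNReal.ofReal (d.R ^ 2 * weightMass (EuclideanSpace ℝ ι) d.K₀) := by
        rw [Finset.sum_const, Finset.card_univ, nsmul_eq_mul]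

/-- **`u(t) ∈ L²`** for every `t`. [folklore] -/
theorem memLp_u (t : ℝ) : MemLp (d.u t) 2 volume := by
  refine ⟨(d.continuous_u t).aestronglyMeasurable, ?_⟩
  rw [eLpNorm_two_eq_sqrt]
  refine ENNReal.rpow_lt_top_of_nonneg (by norm_num) (ne_of_lt (lt_of_le_of_lt (d.lintegral_u_sq_le t) ?_))
  exact ENNReal.mul_lt_top (ENNReal.natCast_lt_top _) ENNReal.ofReal_lt_top

/-! ### Time continuity in `L²` -/

/-- Dominated convergence on the Fourier side: `∫ ‖v_l(t) − v_l(t₀)‖² → 0` as `t → t₀`. [folklore] -/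
theorem tendsto_lintegral_v_sub (t₀ : ℝ) (l : ι) :
    Tendsto (fun t => ∫⁻ ξ, ‖d.v t ξ l - d.v t₀ ξ l‖ₑ ^ 2) (𝓝 t₀) (𝓝 0) := by
  have hI := integrable_inv_one_add_norm_pow (E := EuclideanSpace ℝ ι) (finrank_lt_of_card_lt d.hK₀)
  have hR := d.hyp.R_nonneg
  set bound : EuclideanSpace ℝ ι → ℝ≥0∞ := fun ξ => ENNReal.ofReal ((2 * d.R) ^ 2 * ((1 + ‖ξ‖) ^ d.K₀)⁻¹)
  have h := tendsto_lintegral_filter_of_dominated_convergence (μ := volume) (l := 𝓝 t₀)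
    (F := fun t ξ => ‖d.v t ξ l - d.v t₀ ξ l‖ₑ ^ 2) (f := fun _ => 0) bound ?_ ?_ ?_ ?_
  · simpa using h
  · refine Eventually.of_forall fun t => ?_
    have hm : Measurable fun ξ => d.v t ξ l - d.v t₀ ξ l :=
      (measurable_pi_apply l).comp ((d.continuous_v_slice t).sub (d.continuous_v_slice t₀)).measurable
    exact hm.enorm.pow_const 2
  · refine Eventually.of_forall fun t => Eventually.of_forall fun ξ => ?_
    have hdec : HasDecay d.K₀ (d.R + d.R) (fun ξ => d.v t ξ l - d.v t₀ ξ l) :=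
      ((d.decay_v t).apply l).sub ((d.decay_v t₀).apply l)
    simp only [bound]
    rw [← ofReal_norm, ← ENNReal.ofReal_pow (norm_nonneg _)]
    refine ENNReal.ofReal_le_ofReal ?_
    have h1 := hdec ξ
    have hw := inv_one_add_norm_pow_le_one ξ d.K₀
    have hw0 : 0 ≤ ((1 + ‖ξ‖) ^ d.K₀)⁻¹ := by positivity
    calc ‖d.v t ξ l - d.v t₀ ξ l‖ ^ 2 ≤ ((d.R + d.R) * ((1 + ‖ξ‖) ^ d.K₀)⁻¹) ^ 2 :=
          pow_le_pow_left₀ (norm_nonneg _) h1 2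
      _ = (2 * d.R) ^ 2 * ((1 + ‖ξ‖) ^ d.K₀)⁻¹ * ((1 + ‖ξ‖) ^ d.K₀)⁻¹ := by ring
      _ ≤ (2 * d.R) ^ 2 * ((1 + ‖ξ‖) ^ d.K₀)⁻¹ * 1 := by gcongr
      _ = (2 * d.R) ^ 2 * ((1 + ‖ξ‖) ^ d.K₀)⁻¹ := mul_one _
  · simp only [bound]
    rw [← ofReal_integral_eq_lintegral_ofReal (hI.const_mul _)
      (Eventually.of_forall fun ξ => by positivity)]
    exact ENNReal.ofReal_ne_top
  · refine Eventually.of_forall fun ξ => ?_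
    have hc : Continuous fun t => d.v t ξ l :=
      (continuous_apply l).comp (d.continuous_v.comp (continuous_id.prodMk continuous_const))
    have h2 : Tendsto (fun t => ‖d.v t ξ l - d.v t₀ ξ l‖ₑ ^ 2) (𝓝 t₀)
        (𝓝 (‖d.v t₀ ξ l - d.v t₀ ξ l‖ₑ ^ 2)) :=
      ((ENNReal.continuous_pow 2).comp (hc.sub continuous_const).enorm).tendsto t₀
    simpa using h2

/-- `∫ ‖u(t) − u(t₀)‖² → 0` as `t → t₀` (Plancherel componentwise). [folklore] -/
theorem tendsto_lintegral_u_sub (t₀ : ℝ) :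
    Tendsto (fun t => ∫⁻ x, ‖d.u t x - d.u t₀ x‖ₑ ^ 2) (𝓝 t₀) (𝓝 0) := by
  have hvj : ∀ t j, Integrable fun ξ => d.v t ξ j := fun t j =>
    ((d.decay_v t).apply j).integrable (finrank_lt_of_card_lt d.hK₀) (d.aesm_v t j)
  -- pointwise: `‖u t x - u t₀ x‖² ≤ ∑ₗ ‖𝓕 (v_l t - v_l t₀) x‖²`
  have hpt : ∀ t x, ‖d.u t x - d.u t₀ x‖ₑ ^ 2 ≤
      ∑ l, ‖𝓕 (fun ξ => d.v t ξ l - d.v t₀ ξ l) x‖ₑ ^ 2 := by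
    intro t x
    have hsub : d.u t x - d.u t₀ x = reVec (fun l => 𝓕 (fun ξ => d.v t ξ l - d.v t₀ ξ l) x) := by
      have : d.u t x - d.u t₀ x = reVec (d.U t x - d.U t₀ x) := by
        simp only [u, map_sub]
      rw [this]
      congr 1
      funext l
      rw [Pi.sub_apply, U, U, ← fourier_sub' (hvj t l) (hvj t₀ l)]
      rfl
    rw [hsub]
    exact enorm_reVec_sq_le _
  have hsum : Tendsto (fun t => ∑ l, ∫⁻ x, ‖𝓕 (fun ξ => d.v t ξ l - d.v t₀ ξ l) x‖ₑ ^ 2) (𝓝 t₀)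
      (𝓝 0) := by
    rw [show (0 : ℝ≥0∞) = ∑ _l : ι, 0 by simp]
    refine tendsto_finsetSum _ fun l _ => ?_
    have heq : ∀ t, ∫⁻ x, ‖𝓕 (fun ξ => d.v t ξ l - d.v t₀ ξ l) x‖ₑ ^ 2 =
        ∫⁻ ξ, ‖d.v t ξ l - d.v t₀ ξ l‖ₑ ^ 2 := fun t =>
      lintegral_sq_fourier_eq ((hvj t l).sub (hvj t₀ l))
        (memLp_two_of_hasDecay d.hK₀ (((d.decay_v t).apply l).sub ((d.decay_v t₀).apply l))
          ((d.aesm_v t l).sub (d.aesm_v t₀ l)))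
    simp_rw [heq]
    exact d.tendsto_lintegral_v_sub t₀ l
  refine tendsto_of_tendsto_of_tendsto_of_le_of_le tendsto_const_nhds hsum (fun _ => bot_le) fun t => ?_
  calc ∫⁻ x, ‖d.u t x - d.u t₀ x‖ₑ ^ 2 ≤ ∫⁻ x, ∑ l, ‖𝓕 (fun ξ => d.v t ξ l - d.v t₀ ξ l) x‖ₑ ^ 2 :=
        lintegral_mono (hpt t)
    _ = ∑ l, ∫⁻ x, ‖𝓕 (fun ξ => d.v t ξ l - d.v t₀ ξ l) x‖ₑ ^ 2 := by
        refine lintegral_finsetSum' _ fun l _ => ?_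
        exact (continuous_fourierIntegral ((hvj t l).sub (hvj t₀ l))).measurable.enorm.pow_const 2
          |>.aemeasurable

/-- **`u ∈ C([0, T]; L²)`** (indeed on all of `ℝ`, by clamping). [folklore] -/
theorem continuousInLpOn_u : ContinuousInLpOn (Icc 0 d.T) 2 d.u := by
  refine ⟨fun t _ => d.memLp_u t, fun t₀ _ => ?_⟩
  have h : Tendsto (fun t => eLpNorm (d.u t - d.u t₀) 2 volume) (𝓝 t₀) (𝓝 0) := by
    have h1 : ∀ t, eLpNorm (d.u t - d.u t₀) 2 volume = (∫⁻ x, ‖d.u t x - d.u t₀ x‖ₑ ^ 2) ^ (1 / 2 : ℝ) :=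
      fun t => eLpNorm_two_eq_sqrt _
    simp_rw [h1]
    have h2 := (ENNReal.continuous_rpow_const (y := (1 / 2 : ℝ))).tendsto 0
    rw [ENNReal.zero_rpow_of_pos (by norm_num)] at h2
    exact h2.comp (d.tendsto_lintegral_u_sub t₀)
  exact h.mono_left nhdsWithin_le_nhds

/-! ### Space–time integrability -/

/-- **`∇u ∈ L²ₜₓ`**: `∫₀ᵀ ∫ |∇u|² < ∞` (uniform-in-time bound `∑_{i,l} ‖2πξᵢ v_l‖₂²`). [folklore] -/
theorem gradient_sq_finite :
    ∫⁻ t in Ioo 0 d.T, ∫⁻ x, ENNReal.ofReal (frobeniusNormSq (fderiv ℝ (d.u t) x)) < ⊤ := by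
  classical
  -- uniform constant
  have hB : ∀ i l : ι, ∃ B, ∀ t, HasDecay d.K₀ B (fun ζ : EuclideanSpace ℝ ι =>
      (-(2 * π * I) * ((ζ i : ℝ) : ℂ)) * d.v t ζ l) := fun i l => d.hasDecay_dv_unif i l
  choose B hBd using hB
  set Cst : ℝ≥0∞ := ∑ i, ∑ l, ENNReal.ofReal (B i l ^ 2 * weightMass (EuclideanSpace ℝ ι) d.K₀) with hCst
  have hCst_top : Cst < ⊤ := by
    simp only [hCst]
    refine ENNReal.sum_lt_top.2 fun i _ => ENNReal.sum_lt_top.2 fun l _ => ENNReal.ofReal_lt_top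
  -- pointwise bound of the Frobenius norm
  have hpt : ∀ t x, ENNReal.ofReal (frobeniusNormSq (fderiv ℝ (d.u t) x)) ≤
      ∑ i, ∑ l, ‖𝓕 (fun ζ : EuclideanSpace ℝ ι => (-(2 * π * I) * ((ζ i : ℝ) : ℂ)) * d.v t ζ l) x‖ₑ ^ 2 := by
    intro t x
    rw [frobeniusNormSq_eq_sum (EuclideanSpace.basisFun ι ℝ)]
    rw [ENNReal.ofReal_sum_of_nonneg fun i _ => by positivity]
    refine Finset.sum_le_sum fun i _ => ?_
    have hvec : fderiv ℝ (d.u t) x ((EuclideanSpace.basisFun ι ℝ) i) =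
        reVec (fun l => 𝓕 (fun ζ : EuclideanSpace ℝ ι => (-(2 * π * I) * ((ζ i : ℝ) : ℂ)) * d.v t ζ l) x) := by
      ext l
      rw [d.fderiv_u_apply, reVec_apply, EuclideanSpace.basisFun_apply]
      congr 2
      refine congrFun (fourier_congr' fun ζ => ?_) x
      rw [EuclideanSpace.inner_single_right]; simp
    rw [hvec, ENNReal.ofReal_pow (norm_nonneg _), ofReal_norm]
    exact enorm_reVec_sq_le _
  have hslice : ∀ t, ∫⁻ x, ENNReal.ofReal (frobeniusNormSq (fderiv ℝ (d.u t) x)) ≤ Cst := by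
    intro t
    calc ∫⁻ x, ENNReal.ofReal (frobeniusNormSq (fderiv ℝ (d.u t) x))
        ≤ ∫⁻ x, ∑ i, ∑ l, ‖𝓕 (fun ζ : EuclideanSpace ℝ ι =>
            (-(2 * π * I) * ((ζ i : ℝ) : ℂ)) * d.v t ζ l) x‖ₑ ^ 2 := lintegral_mono (hpt t)
      _ = ∑ i, ∑ l, ∫⁻ x, ‖𝓕 (fun ζ : EuclideanSpace ℝ ι =>
            (-(2 * π * I) * ((ζ i : ℝ) : ℂ)) * d.v t ζ l) x‖ₑ ^ 2 := by
          rw [lintegral_finsetSum' _ fun i _ => ?_]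
          · refine Finset.sum_congr rfl fun i _ => lintegral_finsetSum' _ fun l _ => ?_
            exact (continuous_fourierIntegral (((hBd i l t)).integrable (finrank_lt_of_card_lt d.hK₀)
              (d.aesm_dv t i l))).measurable.enorm.pow_const 2 |>.aemeasurable
          · refine Finset.aemeasurable_fun_sum _ fun l _ => ?_
            exact (continuous_fourierIntegral (((hBd i l t)).integrable (finrank_lt_of_card_lt d.hK₀)
              (d.aesm_dv t i l))).measurable.enorm.pow_const 2 |>.aemeasurable
      _ ≤ Cst := by
          simp only [hCst]
          refine Finset.sum_le_sum fun i _ => Finset.sum_le_sum fun l _ => ?_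
          exact lintegral_sq_fourier_le d.hK₀ (hBd i l t) (d.aesm_dv t i l)
  calc ∫⁻ t in Ioo 0 d.T, ∫⁻ x, ENNReal.ofReal (frobeniusNormSq (fderiv ℝ (d.u t) x))
      ≤ ∫⁻ _t in Ioo 0 d.T, Cst := lintegral_mono fun t => hslice t
    _ = Cst * volume (Ioo 0 d.T) := setLIntegral_const _ _
    _ < ⊤ := ENNReal.mul_lt_top hCst_top (by rw [Real.volume_Ioo]; exact ENNReal.ofReal_lt_top)

/-- The velocity is uniformly bounded: `‖u(t, x)‖ ≤ card ι · R I`. [folklore] -/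
theorem norm_u_le (t : ℝ) (x : EuclideanSpace ℝ ι) :
    ‖d.u t x‖ ≤ Fintype.card ι * (d.R * weightMass (EuclideanSpace ℝ ι) d.K₀) := by
  calc ‖d.u t x‖ ≤ ∑ l, ‖d.U t x l‖ := norm_reVec_le _
    _ ≤ ∑ _l : ι, d.R * weightMass (EuclideanSpace ℝ ι) d.K₀ :=
        Finset.sum_le_sum fun l _ => norm_fourier_le_of_hasDecay d.hK₀ ((d.decay_v t).apply l) x
    _ = Fintype.card ι * (d.R * weightMass (EuclideanSpace ℝ ι) d.K₀) := by
        rw [Finset.sum_const, Finset.card_univ, nsmul_eq_mul]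

/-- **`u ∈ L³ₜₓ`**: `∫₀ᵀ ∫ ‖u‖³ < ∞` (`‖u‖³ ≤ sup‖u‖ · ‖u‖²`). [folklore] -/
theorem cube_finite : ∫⁻ t in Ioo 0 d.T, ∫⁻ x, ‖d.u t x‖ₑ ^ (3 : ℕ) < ⊤ := by
  set M : ℝ := Fintype.card ι * (d.R * weightMass (EuclideanSpace ℝ ι) d.K₀) with hM
  set C2 : ℝ≥0∞ := Fintype.card ι * ENNReal.ofReal (d.R ^ 2 * weightMass (EuclideanSpace ℝ ι) d.K₀)
  have hC2 : C2 < ⊤ := ENNReal.mul_lt_top (ENNReal.natCast_lt_top _) ENNReal.ofReal_lt_top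
  have hslice : ∀ t, ∫⁻ x, ‖d.u t x‖ₑ ^ (3 : ℕ) ≤ ENNReal.ofReal M * C2 := by
    intro t
    calc ∫⁻ x, ‖d.u t x‖ₑ ^ (3 : ℕ) ≤ ∫⁻ x, ENNReal.ofReal M * ‖d.u t x‖ₑ ^ 2 := by
          refine lintegral_mono fun x => ?_
          rw [pow_succ, mul_comm]
          gcongr
          rw [← ofReal_norm]
          exact ENNReal.ofReal_le_ofReal (d.norm_u_le t x)
      _ = ENNReal.ofReal M * ∫⁻ x, ‖d.u t x‖ₑ ^ 2 := lintegral_const_mul' _ _ ENNReal.ofReal_ne_top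
      _ ≤ ENNReal.ofReal M * C2 := mul_le_mul' le_rfl (d.lintegral_u_sq_le t)
  calc ∫⁻ t in Ioo 0 d.T, ∫⁻ x, ‖d.u t x‖ₑ ^ (3 : ℕ) ≤ ∫⁻ _t in Ioo 0 d.T, ENNReal.ofReal M * C2 :=
        lintegral_mono fun t => hslice t
    _ = ENNReal.ofReal M * C2 * volume (Ioo 0 d.T) := setLIntegral_const _ _
    _ < ⊤ := ENNReal.mul_lt_top (ENNReal.mul_lt_top ENNReal.ofReal_lt_top hC2)
        (by rw [Real.volume_Ioo]; exact ENNReal.ofReal_lt_top)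

/-- **`p u ∈ L¹ₜₓ`**: `∫₀ᵀ ∫ |p| ‖u‖ < ∞` (`|p|‖u‖ ≤ |P|² + ‖u‖²`, Plancherel for `q`). [folklore] -/
theorem pressure_velocity_finite : ∫⁻ t in Ioo 0 d.T, ∫⁻ x, ‖d.p t x‖ₑ * ‖d.u t x‖ₑ < ⊤ := by
  obtain ⟨Bq, hBq⟩ := d.decay_q d.K₀
  set C1 : ℝ≥0∞ := ENNReal.ofReal (Bq ^ 2 * weightMass (EuclideanSpace ℝ ι) d.K₀)
  set C2 : ℝ≥0∞ := Fintype.card ι * ENNReal.ofReal (d.R ^ 2 * weightMass (EuclideanSpace ℝ ι) d.K₀)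
  have hC2 : C2 < ⊤ := ENNReal.mul_lt_top (ENNReal.natCast_lt_top _) ENNReal.ofReal_lt_top
  -- `a b ≤ a² + b²` in `ℝ≥0∞` (also `Literature.Analysis.FluidPDE.ennreal_mul_le_sq_add_sq`, `NSVorticityDifference`)
  have key : ∀ a b : ℝ≥0∞, a * b ≤ a ^ 2 + b ^ 2 := fun a b => by
    rcases le_total a b with h | h
    · calc a * b ≤ b * b := mul_le_mul' h le_rfl
        _ = b ^ 2 := (sq b).symm
        _ ≤ a ^ 2 + b ^ 2 := le_add_self
    · calc a * b ≤ a * a := mul_le_mul' le_rfl h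
        _ = a ^ 2 := (sq a).symm
        _ ≤ a ^ 2 + b ^ 2 := le_self_add
  have hslice : ∀ t, ∫⁻ x, ‖d.p t x‖ₑ * ‖d.u t x‖ₑ ≤ C1 + C2 := by
    intro t
    have hP : ∫⁻ x, ‖d.P t x‖ₑ ^ 2 ≤ C1 := lintegral_sq_fourier_le d.hK₀ (hBq t) (d.aesm_q t)
    calc ∫⁻ x, ‖d.p t x‖ₑ * ‖d.u t x‖ₑ ≤ ∫⁻ x, (‖d.P t x‖ₑ ^ 2 + ‖d.u t x‖ₑ ^ 2) := by
          refine lintegral_mono fun x => ?_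
          calc ‖d.p t x‖ₑ * ‖d.u t x‖ₑ ≤ ‖d.P t x‖ₑ * ‖d.u t x‖ₑ := by
                gcongr
                rw [← ofReal_norm, ← ofReal_norm]
                exact ENNReal.ofReal_le_ofReal (by rw [p, Real.norm_eq_abs]; exact Complex.abs_re_le_norm _)
            _ ≤ ‖d.P t x‖ₑ ^ 2 + ‖d.u t x‖ₑ ^ 2 := key _ _
      _ = (∫⁻ x, ‖d.P t x‖ₑ ^ 2) + ∫⁻ x, ‖d.u t x‖ₑ ^ 2 := by
          refine lintegral_add_left ?_ _
          have hcont : Continuous (d.P t) :=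
            continuous_fourierIntegral ((hBq t).integrable (finrank_lt_of_card_lt d.hK₀) (d.aesm_q t))
          exact hcont.measurable.enorm.pow_const 2
      _ ≤ C1 + C2 := add_le_add hP (d.lintegral_u_sq_le t)
  calc ∫⁻ t in Ioo 0 d.T, ∫⁻ x, ‖d.p t x‖ₑ * ‖d.u t x‖ₑ ≤ ∫⁻ _t in Ioo 0 d.T, (C1 + C2) :=
        lintegral_mono fun t => hslice t
    _ = (C1 + C2) * volume (Ioo 0 d.T) := setLIntegral_const _ _
    _ < ⊤ := ENNReal.mul_lt_top (ENNReal.add_lt_top.2 ⟨ENNReal.ofReal_lt_top, hC2⟩)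
        (by rw [Real.volume_Ioo]; exact ENNReal.ofReal_lt_top)

end ClayDatum

end Literature.Analysis.FluidPDE.FourierNS

/-! ### The existence theorem -/

namespace Literature.Analysis.FluidPDE

open Set MeasureTheory FourierNS
open scoped ENNReal

/-- **Leray's local regular solution for Schwartz-class data** (existence half of
`local_classical_lerayHopf`). For `ν > 0` and `u₀ : ℝ³ → ℝ³` smooth, divergence free and rapidly
decaying (Fefferman (4)), there are `T > 0` and `(u, p)` with `IsClassicalNSSolutionOn (Icc 0 T) ν
0 u p` (jointly smooth on the closed slab, equations up to `t = 0`), `u 0 = u₀`,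
`u ∈ C([0,T]; L²)` (`ContinuousInLpOn`), `∇u ∈ L²((0,T) × ℝ³)`, `u ∈ L³((0,T) × ℝ³)` and
`p u ∈ L¹((0,T) × ℝ³)` — exactly the hypotheses of the proved
`IsClassicalNSSolutionOn.isLerayHopfOn_holds`. Proof: the fields `u = Re 𝓕 v`, `p = Re 𝓕 q`
synthesized from the Fourier-side Picard fixed point (`FourierNS.ClayDatum`, files `NSFourier*`;
Leray's successive approximations of §19 run on the Fourier side), `T` Picard's time. Printed
counterparts: Leray 1934, §19 (existence of the regular solution on `[0, τ)`, pp. 222–223;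
definition and §§16–17, pp. 220–221); Ożański–Pooley 2018, Thm. 6.22, Cor. 6.16, Lemma 6.21,
Lemma 6.9 (iii); smoothness of `u`, `p` up to `t = 0` for `H^m`-data of all orders:
Majda–Bertozzi 2002, Thm. 3.4, Thm. 3.5. [cite: Leray1934, §19 pp. 222–223] -/
theorem local_regular_solution_exists (ν : ℝ) (hν : 0 < ν)
    (u₀ : EuclideanSpace ℝ (Fin 3) → EuclideanSpace ℝ (Fin 3)) (hu₀ : ContDiff ℝ (⊤ : ℕ∞) u₀)
    (hdiv : Literature.Analysis.FluidPDE.NSWave0.IsDivFree u₀) (hdec : Literature.Analysis.FluidPDE.HasRapidSpatialDecay u₀) :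
    ∃ T : ℝ, 0 < T ∧
      ∃ (u : ℝ → EuclideanSpace ℝ (Fin 3) → EuclideanSpace ℝ (Fin 3))
        (p : ℝ → EuclideanSpace ℝ (Fin 3) → ℝ),
        IsClassicalNSSolutionOn (Icc 0 T) ν 0 u p ∧ u 0 = u₀ ∧
        ContinuousInLpOn (Icc 0 T) 2 u ∧
        (∫⁻ t in Ioo 0 T, ∫⁻ x, ENNReal.ofReal (frobeniusNormSq (fderiv ℝ (u t) x)) < ∞) ∧
        (∫⁻ t in Ioo 0 T, ∫⁻ x, ‖u t x‖ₑ ^ (3 : ℕ) < ∞) ∧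
        (∫⁻ t in Ioo 0 T, ∫⁻ x, ‖p t x‖ₑ * ‖u t x‖ₑ < ∞) := by
  let d : ClayDatum (Fin 3) := ⟨ν, hν, u₀, hu₀, hdiv, hdec⟩
  exact ⟨d.T, d.T_pos, d.u, d.p, d.isClassicalNSSolutionOn, d.u_zero, d.continuousInLpOn_u,
    d.gradient_sq_finite, d.cube_finite, d.pressure_velocity_finite⟩

end Literature.Analysis.FluidPDE

end
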